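import Summits.QuantumFields.BalabanUV.T4Continuum.Support.NE7FlatInteriorGradientDivForm
import HarnessLib

/-!
# NE7FlatInteriorEstimateDivForm — THE MATRIX-VALUED INTERIOR C¹ LETTER WITH A DIVERGENCE-FORM SOURCE, IN THE SHAPE REQUESTED BY ROW NE7 ([NE7P1-G108-INBOX-4],
# «PREFERRED FORM (scalar, cutoff internal)»): `Σ_μ[(u(y+e_μ) − u y) − (u y − u(y−e_μ))] = flatDiv q y + r y`, `‖q‖ ≤ Q`, `‖r‖ ≤ A`, `‖u‖ ≤ S` on `cube x (3m)` ⟹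
# `‖u(x + e_j) − u x‖ ≤ C·((1 + log m)·Q + m·A + S∕m)` (`interior_estimate_divForm`)

Cell `pub-balaban`, rung (B)+1 sub-cell t4; row-NE7b owner lineage `b2b-balaban-t4-ne7b-p1` (gen 155).  **INTERFACE REQUEST NE7→NE7b, stub (S-h) PART (b), PREFERRED FORM** of t4-ne7-p1 g108
([NE7P1-G108-INBOX-4]: pv23's I3 `PoissonInterior.interior_estimate` «with the source split into a DIVERGENCE-FORM part charged through `|∇dG₀| ≤ C₂nrm^{−d}` after one more summation by parts …
and a bounded part charged as in I3; the ℓ¹ size `B` of I3 replaced by the sup `S`»).  The real-valued core is this lineage's `NE7FlatInteriorGradientDivForm.interior_gradient_divForm`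
(p800255, over `NE7FlatInteriorCoreDivForm.core_bound_divForm` p799794); THIS FILE passes to `Matrix n n ℂ`-valued `u, q, r` through real functionals (`NormedSpace.norm_le_dual_bound`, gen 154's
pattern) and re-packages the logarithm (`1 + log⁺(3m) ≤ 3(1 + log m)`).  USE (the road's (S-h)(c)): `u = B_{μν}` in a comb gauge on `cube x₀ (3M)`, `q` from the tension and the Bianchi cyclic sum
(`Q = O(εη³)`), `r` = curvature commutators, `S = 2a`, `m = M` ⟹ `‖∇_U F‖ ≤ c(1+k)η³` — (10) TYPE up to the affordable log.
WHAT ([folklore]; 0 def, 0 sorry).  `lap_dual_apply_fun` (the scalar Laplacian of `f∘u`), `flatDiv_dual_apply`, `one_add_posLog_three_mul_le` (`1 + log⁺(3m) ≤ 3(1 + log m)`, `m ≥ 1`),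
**`interior_estimate_divForm`** (`d ≥ 3`; `q` needs to be bounded on `cube x (3m)` only — the request's `cube x (3m+1)` implies it).
HONEST FRAMING (page 1): flat `ℤ^d` potential theory, [folklore]; constants inherit lit1's existential Green-function constants; nothing of Bałaban's asserted; (S-h)(a)(c) and (10) TYPE are
the road's and NOT proved here; NE3∕NE7 NOT proved; row NE7b NOT PRINTED ∕ NOT PROVED; spine count = dagwriter's call; finite T⁴ rung (B)+1 — NOT infinite volume, NOT mass gap, NOT BetaPertH, NOT Clay.
-/

set_option autoImplicit false

open scoped BigOperators Matrix.Norms.L2Operator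
open Finset

namespace Summit.QuantumFields.BalabanUV.T4Continuum.NE7FlatInteriorEstimateDivForm

open Literature.MathematicalPhysics.QuantumFieldTheory.Balaban1983to89
open B7Prop1Explicit (Site e)
open NE3CoercivityScaling (flatDiv)
open Literature.Probability.LatticeModels (latticeLaplacianZd latticeLaplacianZd_def)
open Beta.PoissonInterior (cube mem_cube)
open NE7FlatInteriorGradientDivForm (interior_gradient_divForm)

noncomputable section

variable {d : ℕ} {n : Type*} [Fintype n] [DecidableEq n]

/-! ## §1 Real functionals through the lattice Laplacian and the flat divergence; the logarithm re-packaged -/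

omit [Fintype n] [DecidableEq n] in
/-- The scalar Laplacian of a real-linear functional of a matrix field is the functional of the componentwise Laplacian:
`Δ(f∘u)(y) = f(Σ_μ[(u(y+e_μ) − u y) − (u y − u(y−e_μ))])`. [folklore] -/
theorem lap_dual_apply_fun (f : Matrix n n ℂ →L[ℝ] ℝ) (u : Site d → Matrix n n ℂ) (y : Site d) :
    latticeLaplacianZd (fun z => f (u z)) y = f (∑ μ : Fin d, ((u (y + e μ) - u y) - (u y - u (y - e μ)))) := by
  rw [map_sum, latticeLaplacianZd_def]
  have he : ∀ i : Fin d, (e i : Site d) = Pi.single i 1 := fun i => rfl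
  have hsum : ∀ i : Fin d, f ((u (y + e i) - u y) - (u y - u (y - e i))) = (f (u (y + Pi.single i 1)) + f (u (y - Pi.single i 1))) - 2 * f (u y) := by
    intro i
    rw [map_sub, map_sub, map_sub, he]
    ring
  simp_rw [hsum]
  rw [Finset.sum_sub_distrib, Finset.sum_const, Finset.card_univ, Fintype.card_fin, nsmul_eq_mul]
  ring

omit [Fintype n] [DecidableEq n] in
/-- A real functional passes through the flat (backward) divergence: `f(flatDiv q y) = Σ_μ (f(q(y,μ)) − f(q(y−e_μ,μ)))`. [folklore] -/
theorem flatDiv_dual_apply (f : Matrix n n ℂ →L[ℝ] ℝ) (q : Site d → Fin d → Matrix n n ℂ) (y : Site d) :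
    f (flatDiv q y) = ∑ μ : Fin d, ((fun z μ => f (q z μ)) y μ - (fun z μ => f (q z μ)) (y - Pi.single μ 1) μ) := by
  simp only [flatDiv, map_sum, map_sub]
  rfl

omit [Fintype n] [DecidableEq n] in
/-- `1 + log⁺(3m) ≤ 3·(1 + log m)` for `m ≥ 1`. [folklore] -/
theorem one_add_posLog_three_mul_le {m : ℕ} (hm : 1 ≤ m) : 1 + Real.posLog ((3 * m : ℕ) : ℝ) ≤ 3 * (1 + Real.log (m : ℝ)) := by
  have hm1 : (1 : ℝ) ≤ m := by exact_mod_cast hm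
  have hlogm : 0 ≤ Real.log (m : ℝ) := Real.log_nonneg hm1
  have hx : (1 : ℝ) ≤ ((3 * m : ℕ) : ℝ) := by exact_mod_cast (by omega : 1 ≤ 3 * m)
  rw [Real.posLog_eq_log (by rw [abs_of_pos (by positivity)]; exact hx)]
  have hsplit : Real.log ((3 * m : ℕ) : ℝ) = Real.log 3 + Real.log (m : ℝ) := by
    push_cast; rw [Real.log_mul (by norm_num) (by positivity)]
  have hlog3 : Real.log 3 ≤ 2 := by
    have h := Real.log_le_sub_one_of_pos (show (0 : ℝ) < 3 / 4 by norm_num)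
    have h2 : Real.log 3 = Real.log (3 / 4) + 2 * Real.log 2 := by
      rw [Real.log_div (by norm_num) (by norm_num), show (4 : ℝ) = 2 ^ 2 by norm_num, Real.log_pow]; ring
    have hl2 : Real.log 2 ≤ 0.6931471808 := Real.log_two_lt_d9.le
    rw [h2]; nlinarith
  rw [hsplit]; nlinarith

/-! ## §2 The matrix-valued interior letter -/

/-- **THE INTERIOR C¹ LETTER WITH A DIVERGENCE-FORM SOURCE, MATRIX-VALUED** (`d ≥ 3`; INTERFACE REQUEST NE7→NE7b (S-h)(b), preferred form): `∃ C = C(d) ≥ 0` such that for every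
`m ≥ 1`, `u, r : ℤ^d → Matrix n n ℂ`, bond field `q`, centre `x` and `Q, A, S ≥ 0`: if on `cube x (3m)` the componentwise Laplacian of `u` is `flatDiv q + r` (backward flat divergence,
`NE3CoercivityScaling.flatDiv`) and `‖q(y,κ)‖ ≤ Q`, `‖r y‖ ≤ A`, `‖u y‖ ≤ S`, then for every `j`, `‖u(x + e_j) − u x‖ ≤ C·((1 + log m)·Q + m·A + S∕m)`.
Proof: every real functional `f∘u` satisfies the real-valued letter `NE7FlatInteriorGradientDivForm.interior_gradient_divForm` with data `‖f‖Q, ‖f‖A, ‖f‖S`; `norm_le_dual_bound`. [folklore] -/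
theorem interior_estimate_divForm (hd : 3 ≤ d) : ∃ C : ℝ, 0 ≤ C ∧ ∀ (m : ℕ), 1 ≤ m →
    ∀ (u : Site d → Matrix n n ℂ) (q : Site d → Fin d → Matrix n n ℂ) (r : Site d → Matrix n n ℂ) (x : Site d) (Q A S : ℝ), 0 ≤ Q → 0 ≤ A → 0 ≤ S →
    (∀ y ∈ cube x (3 * m), ∑ μ : Fin d, ((u (y + e μ) - u y) - (u y - u (y - e μ))) = flatDiv q y + r y) →
    (∀ y ∈ cube x (3 * m), ∀ κ : Fin d, ‖q y κ‖ ≤ Q) → (∀ y ∈ cube x (3 * m), ‖r y‖ ≤ A) → (∀ y ∈ cube x (3 * m), ‖u y‖ ≤ S) →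
    ∀ j : Fin d, ‖u (x + e j) - u x‖ ≤ C * ((1 + Real.log (m : ℝ)) * Q + (m : ℝ) * A + S / m) := by
  obtain ⟨C, hC, h⟩ := interior_gradient_divForm (d := d) hd
  refine ⟨3 * C, by positivity, ?_⟩
  intro m hm u q r x Q A S hQ hA hS hlap hq hr hu j
  have hm0 : (0 : ℝ) < m := by exact_mod_cast hm
  have hm1 : (1 : ℝ) ≤ m := by exact_mod_cast hm
  have hlogm : 0 ≤ Real.log (m : ℝ) := Real.log_nonneg hm1
  have hL := one_add_posLog_three_mul_le hm
  have hpl : 0 ≤ Real.posLog ((3 * m : ℕ) : ℝ) := Real.posLog_nonneg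
  set M : ℝ := 3 * C * ((1 + Real.log (m : ℝ)) * Q + (m : ℝ) * A + S / m) with hM
  have hM0 : 0 ≤ M := by positivity
  refine NormedSpace.norm_le_dual_bound ℝ _ hM0 fun f => ?_
  have hf0 : 0 ≤ ‖f‖ := norm_nonneg _
  -- the real-valued data of `f`
  have he : ∀ i : Fin d, (e i : Site d) = Pi.single i 1 := fun i => rfl
  have hlapf : ∀ y ∈ cube x (3 * m), latticeLaplacianZd (fun z => f (u z)) y
      = (∑ μ : Fin d, ((fun z μ => f (q z μ)) y μ - (fun z μ => f (q z μ)) (y - Pi.single μ 1) μ)) + (fun z => f (r z)) y := by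
    intro y hy
    rw [lap_dual_apply_fun, hlap y hy, map_add, flatDiv_dual_apply]
  have hqf : ∀ y ∈ cube x (3 * m), ∀ μ : Fin d, |(fun z μ => f (q z μ)) y μ| ≤ ‖f‖ * Q := fun y hy μ =>
    (Real.norm_eq_abs _ ▸ f.le_opNorm _).trans (mul_le_mul_of_nonneg_left (hq y hy μ) hf0)
  have hrf : ∀ y ∈ cube x (3 * m), |(fun z => f (r z)) y| ≤ ‖f‖ * A := fun y hy =>
    (Real.norm_eq_abs _ ▸ f.le_opNorm _).trans (mul_le_mul_of_nonneg_left (hr y hy) hf0)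
  have huf : ∀ y ∈ cube x (3 * m), |(fun z => f (u z)) y| ≤ ‖f‖ * S := fun y hy =>
    (Real.norm_eq_abs _ ▸ f.le_opNorm _).trans (mul_le_mul_of_nonneg_left (hu y hy) hf0)
  have hreal := h m hm (fun z => f (u z)) (fun z μ => f (q z μ)) (fun z => f (r z)) x (‖f‖ * Q) (‖f‖ * A) (‖f‖ * S)
    (by positivity) (by positivity) (by positivity) hlapf hqf hrf huf j
  rw [← he] at hreal
  have e1 : (fun z => f (u z)) (x + e j) - (fun z => f (u z)) x = f (u (x + e j) - u x) := by simp only [map_sub]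
  rw [e1, ← Real.norm_eq_abs] at hreal
  refine hreal.trans ?_
  -- `C·((1+log⁺3m)·‖f‖Q + m‖f‖A + ‖f‖S∕m) ≤ 3C(1+log m)Q‖f‖ + …`
  have h1 : (1 + Real.posLog ((3 * m : ℕ) : ℝ)) * (‖f‖ * Q) ≤ 3 * (1 + Real.log (m : ℝ)) * (‖f‖ * Q) :=
    mul_le_mul_of_nonneg_right hL (by positivity)
  have h2 : (m : ℝ) * (‖f‖ * A) ≤ 3 * ((m : ℝ) * (‖f‖ * A)) := by nlinarith [mul_nonneg hm0.le (mul_nonneg hf0 hA)]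
  have h30 : 0 ≤ ‖f‖ * S / m := by positivity
  have h3 : ‖f‖ * S / m ≤ 3 * (‖f‖ * S / m) := by linarith
  calc C * ((1 + Real.posLog ((3 * m : ℕ) : ℝ)) * (‖f‖ * Q) + (m : ℝ) * (‖f‖ * A) + ‖f‖ * S / m)
      ≤ C * (3 * (1 + Real.log (m : ℝ)) * (‖f‖ * Q) + 3 * ((m : ℝ) * (‖f‖ * A)) + 3 * (‖f‖ * S / m)) :=
        mul_le_mul_of_nonneg_left (add_le_add (add_le_add h1 h2) h3) hC
    _ = M * ‖f‖ := by rw [hM]; ring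

end

end Summit.QuantumFields.BalabanUV.T4Continuum.NE7FlatInteriorEstimateDivForm
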